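import Summits.QuantumFields.YangMills.Theorems.BalabanUVNodesN12MinimiserFamilyKnitRowThm1LettersAtLengthOnZ
import Summits.QuantumFields.YangMills.Theorems.BalabanUVNodesN12HsurjOfClass
import HarnessLib

/-!
# BalabanUVNodes ∕ N12 — THE KNIT's (J0′) ROW FOR EVERY BASE FIELD OF THE STRICT GUARD, OF RECORD, AT-LENGTH EDITION: `N12MinimiserFamilyKnitRowThm1LettersAtLengthOnZ.
# exists_R_hMinRow_of_thm1LettersAtLength_alongOrbit_onZ` with the per-height letters DISCHARGED (dag-n12-w6's `N12HsurjOfClass.exists_hsurjLetters`) — displayed: the record numerics,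
# dag-n12-w6's (σ)_N numerics, the two [15] letters `h15T` ∕ `h15EUT` READ AT THE INSTANCE's OWN LENGTH `k`; announced: `ρ″`, `εH`, `δ₀`; then per window ∕ region box ∕ tolerances: `∃ R > 0, ∀ V_k, strict guard → <12Q ∕ 12X-W v11 hMin ∀-body, bound 4𝓐₀>`
# ([Balaban1985Variational] (1) p.277, (2)–(7) p.278, Thm 1 (8) p.279, Sect. C (44)–(48) p.285, (81)–(83) p.290, Sect. G pp.305–307, (181) p.307, Prop. 9 (190) p.309;
# [Balaban1989LargeFieldI] (1.74) p.192, p.193 ll.14–20, Prop. 1 p.194; [Balaban1985RegularSpaces] (1.3)–(1.9) p.77; [Balaban1989LargeFieldII] p.357, (1.7)–(1.9) p.358,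
# (1.12)–(1.13) p.359; [Balaban1988Convergent] (2.1)–(2.2) pp.254–255, (2.10)–(2.13) pp.256–257, (2.18) p.257; [Balaban1985Averaging] (8)–(9) pp.18–19, Prop. 2 (52)–(54) p.26,
# (122)–(126) p.36; [Balaban1987RG1] (0.4) p.253)

Cell `pub-ymgap` (HUMAN RULINGS D-0062 ∕ D-0149), seat `pub-ymgap-dag-n12-d` g26 (R134 N12 [B15] s2 = by-name knit at the record; census item E1 = the (J0′) row; count-neutral helper of K1⁹
`stmt-QuantumFields-27364`, `--kind proof --supports … --as helper`).  THEOREMS ONLY (0 `def`, 0 `instance`, 0 `sorry`); ONE composition BY NAME.  AT-LENGTH EDITION of this seat's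
`…KnitRowThm1LettersOnZOfRecord` (p735556, g25) ∕ the lane dag-n12-c g29's length-guarded re-key `…KnitRowThm1LettersOnZOfRecordPos` (p739277) — the text of the latter byte for byte
except the two [15] letter binders (now AT THE INSTANCE's LENGTH `k`, no `∀ k'`), the junction called (`…KnitRowThm1LettersAtLengthOnZ.exists_R_hMinRow_of_thm1LettersAtLength_alongOrbit_onZ`),
names and this header.  Seventh leaf of the junction family (own leaf for the 400-line rule).

WHAT.  The onZ junction of record (`…KnitRowThm1LettersOnZ` §2, p734359) displays per (instance, height) the existence letters `ρ″`∕`hsbU` ([4]'s averaging smallness radius) and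
`εH`∕`B`∕`hHB` (the bounded right inverse of the constrained chart's derivative) — inhabited, for every instance and height, by dag-n12-w6 g11's `N12HsurjOfClass.exists_hsurjLetters`
(`ρ″, εH` from `(Kt, k)` alone, `B` per `(M₁, Z)`).  THIS FILE discharges them: what stays displayed is the record numerics (`3 ≤ d`, `1 ≤ k`, `k + 1 ≤ m + K`, `LᵏM₁`-side ∣ `sitesPerDir 0`,
`(d+14)L ≤ M₁`, `IsBlockUnion k Z`), the (σ)_N numerics (`hkc hc hMrad hM₁`) and the two [15] letters `h15T` ((8)) ∕ `h15EUT` (existence ∕ uniqueness modulo tower-central gauges) over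
NODE 00's torus class READ AT THE INSTANCE's OWN LENGTH `k` (no quantification over lengths); ANNOUNCED: `ρ″ > 0`, `εH > 0`, `δ₀ > 0`; then for every fine window with 12Q v11's geometry rows, print's region box (lit-balaban ME #45∕#46: print's own
scope — every class-(i) component of `Z` is a rectangular parallelepiped inside a `100MR_k`-cube, [Balaban1988Convergent] p.255 after (2.3), [Balaban1989LargeFieldI] (i) p.177; `Λ` a box), guard radius `eR` within the budget, extension, `𝓐₀ > 1`, class tolerance `εr` (five rows + [15]'s comparability rows at `ε := 2eR`), datum
tolerance `ρn` (U3's «T ≤ δ₀» + the normaliser's coupling): `∃ R > 0, ∀ V_k, PlaqSmallOn (plaqsInside (pts k (Z ∩ Λᶜ))) eR V_k → <the knit's hMin ∀-body at V_k, radius R, bound 4𝓐₀,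
class at εr>`.


WHY AT LENGTH (dag-n12-d g26; LOCATED typing-strength of a displayed letter vs its producer of record, count-neutral).  The `_pos` editions display `h15T` ∕ `h15EUT⁺` quantified over ALL
lengths `k' ≤ m + K` although the junction reads them once, at `k' = k`.  The (8)-letter's producer of record is the K0 road, whose REGISTERED currency (K0⁷ stmt-QuantumFields-20541,
skeleton V22-Z: stub-1 text `K0V22ZDefs.Prop8StepCoPGridGAt F` → dag-n07-e's `variationalThm1RegSepCoP7MG_of_prop8TopStepG`) is the GRID-GUARDED sentence
`Node00.VariationalThm1RegSepCoP7MG F 2 A‴(c, c₀, c₁) B₃ a₀ a₁` — it serves the torus-class letter only at lengths `k'` with `k' + c₀ ≤ m + K` (and numerics `c ≤ M₁`, `L^{c₁} ∣ M₁`), never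
at all `k' ≤ m + K`; the floor-free `…SepCoP7M` named in the «INHABITED BY» comments implies every guarded sentence (`.toG`), not conversely.  THIS EDITION therefore displays both
letters AT THE INSTANCE's OWN LENGTH `k`, so that ANY producer guarded in the length serves exactly the instances passing its guard — the K0-keyed head is
`BalabanUVNodesN12MinimiserFamilyKnitRowOfK0GridGOnZOfRecord` (next leaf) — and the `_pos` letters serve every instance (instantiate at `k`).  Proof: ✓p739277's, the junction renamed.

HONEST FRAMING ∕ LOCATED.  One composition by name; [15] Thm 1 ((8), existence, uniqueness) stays DISPLAYED as the two letters `h15T`∕`h15EUT` at the instance's length `k ≥ 1` (producer of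
`h15T` = the K0 road's guarded (8)-token at instances passing its guard, K0⁷ OPEN; `h15EUT` = [15] Thm 1 (E∕U) has NO producer in the tree — orphan edge N07→N12) — THE remaining substance of E1 on the knit side, together with census U4 (`δ₀`, `R`, `ρ″`, `εH` are EXISTENCE constants per (instance, height); print's volume-uniform
(46)∕(83) and `k`-uniformity NOT claimed); box scope displayed; nothing of Bałaban's estimates asserted; count-neutral; N12 NOT discharged; K1⁹ NOT closed; counts unmoved; one finite 𝕋⁴
programme at fixed `ε = L^{-K}` — R4 closes only the conditional rung `BalabanLadder.UV`; no summit statement is proved here and NOT the Yang–Mills mass gap (Clay); nothing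
continuum ∕ ℝ⁴ ∕ OS.
-/

noncomputable section

namespace Summit.QuantumFields.YangMills.BalabanUVNodes.N12MinimiserFamilyKnitRowThm1LettersAtLengthOnZOfRecord

open scoped BigOperators Matrix.Norms.L2Operator Topology
open Literature.MathematicalPhysics.QuantumFieldTheory.Balaban1983to89
open T4Continuum
open B15DeterminingSets GaugeField
open ExpMeanLog (expMeanLogSU deltaSU)
open T4AdjointCovarianceUnitary (lieSU)
open Node00
open B15Prop1AnalyticExtClause (cplxVec)
open B15Prop1ChartCalculusSU2 (E3)
open T4CubeChartGnomonic (SU2)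
open B14.Eq213DetSet (Bj maxDomT)
open B14.Eq213MaximalDomains (side)
open B14.Eq22Determines (IsBlockUnion)
open B14.Eq216Concrete (feeds)
open B5Eq118OneStroke (iterBlockOf)
open B15Eq112TorusCover (lift)
open T4AxialGaugeSmallField (boxPlaqs castSite)
open B15Prop1Carrier (plaqsInside)
open Literature.MathematicalPhysics.QuantumFieldTheory.BalabanImbrieJaffe1984to88.BIJ85Eq453GaugeField (qsstarGIter0)
open B15ShellGauge193 (shellGauge)
open B15Extension193 (extend)
open B16Sect1Backgrounds (toMS expMul)
open B15Prop1ChartSU2 (su2Chart)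
open Metric (ball)
open B15Prop1ClosedGuardUniformRadius (isCompact_setOf_plaqLeOn plaqLeOn_of_plaqSmallOn)
open B15ShellGauge193Local (dist1_plaqHol_extend_shellGauge_le)
open B15Extension193 (cutoff primed Touches)
open B12ContinuousTransportInvarianceOn (continuous_dist1_SU)
open T4AxialGaugeSmallField (boxBonds)
open B15Prop1MinimiserFamilyOfNormalisedSlice (hMinBody_of_datumSlice)
open Summit.QuantumFields.YangMills.BalabanUVNodes.N12MinimiserFamilyKnitRowThm1Letters (boxRow3_of_boxRow5 isCompact_guard_inter_datumSlice)
open Summit.QuantumFields.YangMills.BalabanUVNodes.N12MinimiserFamilyAtRecordBjTowerDatumLettersOnZUniform (hMin_atRecord_Bj_of_printLetters_ofClassDatumLettersOnZUniform)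
open B15Prop1Thm1RowsOfExistsUniqueAtLength (thm1Rows_atZ_of_thm1TorusClass_existsUnique_atLength)
open Summit.QuantumFields.YangMills.BalabanUVNodes.N12MinimiserFamilyKnitRowThm1LettersAtLengthOnZ (exists_R_hMinRow_of_thm1LettersAtLength_alongOrbit_onZ)

open Summit.QuantumFields.YangMills.BalabanUVNodes.N12HsurjOfClass (exists_hsurjLetters)

variable {F : T4Family} {k : ℕ}



/-! ## §1  The onZ orbit junction of record with the per-height letters discharged -/

/-- ★★★★★ **THE KNIT's (J0′) ROW FOR EVERY BASE FIELD OF THE STRICT GUARD, PER-HEIGHT LETTERS DISCHARGED, [15] LETTERS AT THE INSTANCE's LENGTH** —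
`N12MinimiserFamilyKnitRowThm1LettersAtLengthOnZ.exists_R_hMinRow_of_thm1LettersAtLength_alongOrbit_onZ` ∘ dag-n12-w6's `N12HsurjOfClass.exists_hsurjLetters` (at `M₁ := ν.M₁`, `1 ≤ M₁` from the
floor): displayed ONLY the record numerics, the (σ)_N numerics `hkc hc hMrad hM₁` and the two [15] letters `h15T`∕`h15EUT` READ AT THIS INSTANCE's LENGTH `k`; announced `ρ″ > 0`, `εH > 0`, `δ₀ > 0`; then per window (rows `hn hN5 hlohi hbox hZ`), region box
(`LO HI n′` rows + box scope), `cE` + budget, `ext`, `𝓐₀`, `εr` (five rows), `ε₀` (four comparability rows at `ε := 2eR`), `ρn` («T ≤ δ₀», coupling):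
`∃ R > 0, ∀ V_k, strict guard → <12Q ∕ 12X-W v11 hMin ∀-body at V_k, bound 4𝓐₀, class at εr>`.
[cite: Balaban1985Variational, (2)–(7) p.278, Thm 1 (8) p.279, Sect. C (44)–(48) p.285, (81)–(83) p.290, Sect. G pp.305–307, (181) p.307, Prop. 9 (190) p.309; Balaban1989LargeFieldI, (i) p.177, (1.74) p.192, p.193 L14–20, Prop. 1 p.194; Balaban1988Convergent, p.255 (after (2.3)); Balaban1985RegularSpaces, (1.3)–(1.9) p.77; Balaban1989LargeFieldII, (1.12)–(1.13) p.359; Balaban1988Convergent, (2.1)–(2.2) pp.254–255, (2.10)–(2.13) pp.256–257, (2.18) p.257; Balaban1985Averaging, (8)–(9) pp.18–19, Prop. 2 (52)–(54) p.26, (122)–(126) p.36; Balaban1987RG1, (0.4) p.253] -/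
theorem exists_R_hMinRow_of_thm1LettersAtLength_alongOrbit_onZ_ofRecord (ν : Node00.Stage7Numerics) (Kt : ℕ) (hd3 : 3 ≤ (F.P Kt).d) (Z : Set (Site (F.P Kt) 0))
    (hkK : k + 1 ≤ (F.P Kt).m + (F.P Kt).K) (hk1 : 1 ≤ k) (hdiv : side (F.P Kt).L ν.M₁ k ∣ (F.P Kt).sitesPerDir 0) (hfloor : ((F.P Kt).d + 14) * (F.P Kt).L ≤ ν.M₁) (hZblk : IsBlockUnion k Z)
    -- (σ)_N OF RECORD, onZ EDITION (dag-n12-w6 g18's `N12GaugeLetterLocExplicitOnZ.exists_gaugeLetterLoc_atRecord_explicit_onZ` inside the lane's U3-onZ), instance-level NUMERICS verbatim: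
    -- NUMERICS (i): a level guard `k + c ≤ m + K` with `4d + m′ + 3 < 2·L^c` (no wrapping), and `M₁ ≥ (4d + m′)·L² + 2d·L + 12` (radii), `m′ = 3·(d·((L−1)∕2)) + 5`
    {c : ℕ} (hkc : k + c ≤ (F.P Kt).m + (F.P Kt).K) (hc : 4 * (F.P Kt).d + (3 * ((F.P Kt).d * (((F.P Kt).L - 1) / 2)) + 5) + 3 < 2 * (F.P Kt).L ^ c)
    (hMrad : (4 * (F.P Kt).d + (3 * ((F.P Kt).d * (((F.P Kt).L - 1) / 2)) + 5)) * (F.P Kt).L ^ 2 + 2 * (F.P Kt).d * (F.P Kt).L + 12 ≤ ν.M₁)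
    -- the family's support numerics: `M₁ ≥ ((d+4)L + 6)·L²`
    (hM₁ : (((F.P Kt).d + 4) * (F.P Kt).L + 6) * (F.P Kt).L ^ 2 ≤ ν.M₁)
    -- THE TWO [15]-THEOREM-1 LETTERS over NODE 00's torus class, READ AT THIS INSTANCE's OWN LENGTH `k` (the lane's `_pos` bodies at `k' := k`; at-length edition, dag-n12-d g26, over
    -- `B15Prop1Thm1RowsOfExistsUniqueAtLength`).  «INHABITED BY» (director-ym №300∕№303): `h15T` = (8) — OPEN; producer of record = the K0 road's GRID-GUARDED token
    --   `Node00.VariationalThm1RegSepCoP7MG F 2 A‴(c,c₀,c₁) B₃ a₀ a₁` (K0⁷ stmt-QuantumFields-20541, skeleton V22-Z: from the registered stub-1 text `K0V22ZDefs.Prop8StepCoPGridGAt F` by dag-n07-e's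
    --   `variationalThm1RegSepCoP7MG_of_prop8TopStepG`), which serves THIS letter at every instance passing the guard (`BalabanUVNodesN12Thm1LettersAtLengthOfK0GridG`); `h15EUT` = existence ∕
    --   uniqueness modulo tower-central gauges at length `k ≥ 1` — OPEN: NO producer in the tree ([15] Thm 1 (E∕U), orphan edge N07→N12; the all-lengths letter is REFUTED at `k' = 0`, #10640)
    {B₃ a₀ a₁ : ℝ}
    (h15T : ∀ (s : B14.Eq218Concrete.Seq (fun n : ℕ => Node00.unionsOfCubes (F.P Kt) (side (F.P Kt).L ν.M₁ n)) k),
      Node00.Sect2.SeqSeparated ν.M₁ s → 0 < ν.M₁ →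
      ∀ (ε₀ : ℝ) (δ : ℕ → ℝ), (∀ j, j ≤ k → 0 < δ j ∧ δ j ≤ a₁ ∧ B₃ * δ j ≤ ε₀) → (∀ j, j < k → δ j ≤ 2 * δ (j + 1)) →
      (∀ j, j < k → δ (j + 1) ≤ 2 * δ j) → ε₀ ≤ a₀ →
      ∀ W : MSField (F.P Kt) SU2,
        Node00.Sect2.DataSmall7PTop (Node00.avOfRecord F 2 Kt) s.Ω (Node00.suppDomOfRecord F ν Kt s.Ω) k δ W →
        ∀ U₀ : GaugeField (F.P Kt) 0 SU2, IsMinimizer (Node00.avOfRecord F 2 Kt)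
            {U | (∀ j, j ≤ k → PlaqSmallOn (Node00.Sect2.omegaPlaqsTop s.Ω (Node00.suppDomOfRecord F ν Kt s.Ω) j)
                (ε₀ * (F.P Kt).eta j ^ 2) U) ∧
              Node00.Sect2.CoDivClassOnTop s.Ω (Node00.suppDomOfRecord F ν Kt s.Ω) k ε₀ U}
            (genSet s.Ω k) W U₀ →
          (∀ j, j ≤ k → PlaqSmallOn (Node00.Sect2.omegaPlaqsTop s.Ω (Node00.suppDomOfRecord F ν Kt s.Ω) j)
              (B₃ * δ j * (F.P Kt).eta j ^ 2) U₀) ∧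
            ∀ j, j ≤ k → Node00.Sect2.CoDivSmallOn (Node00.Sect2.omegaBondsTop s.Ω (Node00.suppDomOfRecord F ν Kt s.Ω) j)
              (B₃ * δ j * (F.P Kt).eta j ^ 3) U₀)
    (h15EUT : ∀ (s : B14.Eq218Concrete.Seq (fun n : ℕ => Node00.unionsOfCubes (F.P Kt) (side (F.P Kt).L ν.M₁ n)) k),
      Node00.Sect2.SeqSeparated ν.M₁ s → 0 < ν.M₁ →
      ∀ (ε₀ : ℝ) (δ : ℕ → ℝ), (∀ j, j ≤ k → 0 < δ j ∧ δ j ≤ a₁ ∧ B₃ * δ j ≤ ε₀) → (∀ j, j < k → δ j ≤ 2 * δ (j + 1)) →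
      (∀ j, j < k → δ (j + 1) ≤ 2 * δ j) → ε₀ ≤ a₀ →
      ∀ W : MSField (F.P Kt) SU2,
        Node00.Sect2.DataSmall7PTop (Node00.avOfRecord F 2 Kt) s.Ω (Node00.suppDomOfRecord F ν Kt s.Ω) k δ W →
        (∃ U₀ : GaugeField (F.P Kt) 0 SU2, IsMinimizer (Node00.avOfRecord F 2 Kt)
            {U | (∀ j, j ≤ k → PlaqSmallOn (Node00.Sect2.omegaPlaqsTop s.Ω (Node00.suppDomOfRecord F ν Kt s.Ω) j)
                (ε₀ * (F.P Kt).eta j ^ 2) U) ∧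
              Node00.Sect2.CoDivClassOnTop s.Ω (Node00.suppDomOfRecord F ν Kt s.Ω) k ε₀ U}
            (genSet s.Ω k) W U₀) ∧
        ∀ U₁ U₂ : GaugeField (F.P Kt) 0 SU2,
          IsMinimizer (Node00.avOfRecord F 2 Kt)
            {U | (∀ j, j ≤ k → PlaqSmallOn (Node00.Sect2.omegaPlaqsTop s.Ω (Node00.suppDomOfRecord F ν Kt s.Ω) j)
                (ε₀ * (F.P Kt).eta j ^ 2) U) ∧
              Node00.Sect2.CoDivClassOnTop s.Ω (Node00.suppDomOfRecord F ν Kt s.Ω) k ε₀ U}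
            (genSet s.Ω k) W U₁ →
          IsMinimizer (Node00.avOfRecord F 2 Kt)
            {U | (∀ j, j ≤ k → PlaqSmallOn (Node00.Sect2.omegaPlaqsTop s.Ω (Node00.suppDomOfRecord F ν Kt s.Ω) j)
                (ε₀ * (F.P Kt).eta j ^ 2) U) ∧
              Node00.Sect2.CoDivClassOnTop s.Ω (Node00.suppDomOfRecord F ν Kt s.Ω) k ε₀ U}
            (genSet s.Ω k) W U₂ →
          ∃ u : GaugeTransf (F.P Kt) 0 SU2,
            (∀ j, j ≤ k → ∀ b ∈ bondsOf (genSet s.Ω k j), toMS u j b.src = toMS u j b.tgt ∧ ∀ g : SU2, toMS u j b.src * g = g * toMS u j b.src) ∧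
              gaugeAct u U₁ = U₂) :
    -- the per-height letters DISCHARGED (dag-n12-w6 `N12HsurjOfClass.exists_hsurjLetters`): the radius `ρ″` and the window tolerance `εH` announced from (instance, height) alone
    ∃ ρ'' εH : ℝ, 0 < ρ'' ∧ 0 < εH ∧
    ∃ δ₀ : ℝ, 0 < δ₀ ∧
    ∀ (Λ : Set (Site (F.P Kt) 0)) (lo hi : Fin (F.P Kt).d → ℤ) (eR : ℝ), 0 < eR →
    ∀ (n : ℕ), (∀ κ, hi κ ≤ lo κ + n) → (∀ κ, ((hi κ - lo κ + 1).toNat : ℤ) + 5 < ((F.P Kt).sitesPerDir k : ℤ)) → lo ≤ hi →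
      pts k Λ = (castSite '' Set.Icc lo hi : Set (Site (F.P Kt) k)) → (boxPlaqs (lo - 1) (hi + 1) : Set (Plaq (F.P Kt) k)) ⊆ plaqsInside (pts k Z) →
    -- THE REGION BOX of the direct road (dag-n12-w6 §7's big box): `LO ≤ lo − 1`, `hi + 1 ≤ HI`, side budget `n′ < sitesPerDir k`, its plaquettes inside `Z^{(k)}`, and BOX SCOPE: every `k`-bond inside `Z^{(k)}` is a bond of the box
    -- (= print's STANDING shape condition on the class-(i) large-field components: [Balaban1988Convergent] p.255 after (2.3) «if a component of Z_j is contained in a cube of the size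
    -- 100MR_j, then it is a rectangular parallelepiped», [Balaban1989LargeFieldI] (i) p.177 — lit-balaban ME #45∕#46; not a narrowing of print's instance family)
    ∀ (LO HI : Fin (F.P Kt).d → ℤ) (n' : ℕ), LO ≤ lo - 1 → hi + 1 ≤ HI → (∀ κ, HI κ ≤ LO κ + n') → n' < (F.P Kt).sitesPerDir k →
      (boxPlaqs LO HI : Set (Plaq (F.P Kt) k)) ⊆ plaqsInside (pts k Z) → {e : PBond (F.P Kt) k | e.src ∈ pts k Z ∧ e.tgt ∈ pts k Z} ⊆ boxBonds LO HI →
    ∀ {cE : ℝ}, 12 * ((F.P Kt).d : ℝ) * ((n : ℝ) + 2) ^ 2 ≤ cE → 6 * ((((F.P Kt).d - 1 : ℕ)) : ℝ) * (F.P Kt).L ^ k * (2 * ((cE + 1) * eR)) ≤ ρ'' →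
    ∀ (ext : GaugeField (F.P Kt) k SU2 → GaugeField (F.P Kt) k SU2), (∀ W, ext W = extend (pts k Λ) (shellGauge W lo hi) W) →
    ∀ {𝓐₀ : ℝ}, 1 < 𝓐₀ →
    ∀ (εr : ℝ), 0 < εr → 12 * ((((F.P Kt).d - 1 : ℕ)) : ℝ) * (F.P Kt).L * εr ≤ ρ'' → εr ≤ εH →
      (143 * (((((F.P Kt).d + 4 : ℕ) : ℝ)) ^ 2 / 4) ^ 2) * (2 * ((F.P Kt).L : ℝ) ^ 2 * εr) ≤ 1 / 3 →
      2 * (2 * ((F.P Kt).L : ℝ) ^ 2 * εr) ≤ 2 * deltaSU (Fin 2) / ((((F.P Kt).d + 4) * (F.P Kt).L : ℕ) : ℝ) ^ 2 →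
    -- [15]'s comparability rows at `ε := 2eR`
    ∀ {ε₀ : ℝ}, (cE + 1) * (2 * eR) ≤ a₁ → B₃ * ((cE + 1) * (2 * eR)) ≤ εr → εr < ε₀ → ε₀ ≤ a₀ →
    -- the datum bond tolerance `ρn` with U3's «`T(ρn, εr) ≤ δ₀`» row (VERBATIM)
    ∀ {ρn : ℝ}, 0 ≤ ρn →
    (max ρn ((((2 * (∑ i ∈ Finset.range (k + 1), ((F.P Kt).d * (((F.P Kt).L ^ i - 1) / 2) + 1)) + 1 +
                  (3 * ((F.P Kt).d * (((F.P Kt).L - 1) / 2)) + 5) * (F.P Kt).L ^ k : ℕ) : ℝ)) ^ 2 / 4 * (εr * (F.P Kt).eta 0 ^ 2) +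
                ((3 * ((F.P Kt).d * (((F.P Kt).L - 1) / 2)) + 5 : ℕ) : ℝ) * (6 * ((((((F.P Kt).d + 2) * (F.P Kt).L : ℕ) : ℝ) ^ 2 / 4) * (2 * (εr * (F.P Kt).L ^ 2))) * ∑ i ∈ Finset.range k, ((F.P Kt).L : ℝ) ^ i) + ((3 * ((F.P Kt).d * (((F.P Kt).L - 1) / 2)) + 5 : ℕ) : ℝ) * ρn) ≤ δ₀) →
    -- the normaliser's bond tolerance (dag-n12-w6 §7, at `ε := eR`) below the datum tolerance `ρn`
    (((F.P Kt).d : ℝ) * n' + 1) * ((((F.P Kt).d - 1 : ℕ) : ℝ) * n' * ((12 * (F.P Kt).d * (n + 2) ^ 2 + 1) * eR) + 3 * (F.P Kt).d * (n + 2) ^ 2 * eR) ≤ ρn →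
    -- NO PER-BASE-FIELD HYPOTHESIS AND NO ANTECEDENT: the knit's `hMin` ∀-body for EVERY base field of the strict guard, bound `4𝓐₀`
    ∃ R : ℝ, 0 < R ∧ ∀ Vk : GaugeField (F.P Kt) k SU2, PlaqSmallOn (plaqsInside (pts k (Z ∩ Λᶜ))) eR Vk →
      ∃ Ũ : VecField (F.P Kt) k (EuclideanSpace ℂ (Fin 3)) × VecField (F.P Kt) k (EuclideanSpace ℂ (Fin 3)) → PBond (F.P Kt) 0 → Matrix (Fin 2) (Fin 2) ℂ,
        (∀ b i j, DifferentiableOn ℂ (fun z => Ũ z b i j) (ball 0 R)) ∧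
        (∀ z ∈ ball (0 : VecField (F.P Kt) k (EuclideanSpace ℂ (Fin 3)) × VecField (F.P Kt) k (EuclideanSpace ℂ (Fin 3))) R, ∀ b i j, ‖Ũ z b i j‖ ≤ 4 * 𝓐₀) ∧
        ∀ p B' : VecField (F.P Kt) k E3, ‖p‖ < R → ‖B'‖ < R → ∃ U' : GaugeField (F.P Kt) 0 SU2,
          (∀ b, Ũ (cplxVec p, cplxVec B') b = ((U' b : SU2) : Matrix (Fin 2) (Fin 2) ℂ)) ∧
            IsMinimizer (Node00.avOfRecord F 2 Kt) (Node00.regMSCoPOfRecord F 2 {ν with εreg := εr} Kt k (maxDomT ν.M₁ Z)) (Bj ν.M₁ Z k)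
              (avgFamily (Node00.avOfRecord F 2 Kt) (qsstarGIter0 k (expMul su2Chart B' (ext (expMul su2Chart p Vk))))) U' := by
  obtain ⟨ρ'', εH, hρ, hεH0, hsbU, hH⟩ := exists_hsurjLetters (F := F) (k := k) Kt hkK
  have hM1 : 1 ≤ ν.M₁ := by
    have hL := (F.P Kt).L_pos
    nlinarith
  obtain ⟨B, hB0, hHB⟩ := hH ν.M₁ hM1 Z hdiv
  obtain ⟨δ₀, hδ₀, h⟩ := exists_R_hMinRow_of_thm1LettersAtLength_alongOrbit_onZ ν Kt hd3 Z hkK hk1 hdiv hfloor hZblk hsbU hρ hHB hB0 hkc hc hMrad hM₁ h15T h15EUT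
  exact ⟨ρ'', εH, hρ, hεH0, δ₀, hδ₀, h⟩

end Summit.QuantumFields.YangMills.BalabanUVNodes.N12MinimiserFamilyKnitRowThm1LettersAtLengthOnZOfRecord

end
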